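import Literature.NumberTheory.EllipticCurves.GreenbergSelmerNewform
import Literature.NumberTheory.EllipticCurves.NewformPadicIntegralModel
import Literature.NumberTheory.GaloisRepresentations.GaloisRep
import HarnessLib

/-!
# Route `SignedLowerHalves`, crux L `SmallImageLowerHalfBothSigns` (stmt-BirchSwinnertonDyer-23599), line `rtt_w3` v15 — E2, row J3 residual:
# the side hypothesis `hMP` of `RSeq_cofree_lam` / `exists_junction_exact_cofree_lam_of_hsolL` (R7): INERTIA OFF `P` ACTS TRIVIALLY ON `M = Cofree θ F`
# when the character `θ` is unramified off `P`

WIDTH seat `bsd-line-slh-p3-w3` g23 under LEAD `cruxlead-stmt-BirchSwinnertonDyer-23599` g11 (cell `bsd-ssimc`); helper `--supports stmt-BirchSwinnertonDyer-23599`.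
THEOREMS ONLY; no definition, no named fact, no instance, no `sorry`. Number-field `K` / any-rank twin of the RTT@2 lemma
`ThetaTransport.Reciprocity.smul_cofree_eq_of_mem_inertia'` (which is stated over `ℚ` in the `GreenbergSelmer.inertia` dialect), in the all-primes dialect
`𝔓.inertia (absoluteGaloisGroup K)`, `𝔓 ∈ w.primesAbove` used by R3/R6/R7. HONEST FRAMING: bookkeeping; E2, crux L, crux M, BSD remain OPEN and are proved for NO curve.

* `smul_cofree_eq_of_isUnramifiedAt` — `θ` unramified at `w` ⟹ every `τ ∈ I_𝔓`, `𝔓 ∣ w`, fixes `Cofree θ F` pointwise.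
* `forall_smul_cofree_eq_of_isUnramifiedOutside` — the hypothesis `hMP` of R7 VERBATIM from `∀ w ∉ P, θ.IsUnramifiedAt w`.
References: [SerreAbelianLadic1968] I §2.1; [EmertonPollackWeston2006] §3.1; [GreenbergVatsal2000] §2.
-/

set_option autoImplicit false
set_option linter.dupNamespace false -- D-0017: single-problem summit, the namespace repeats the problem name by design
noncomputable section

open scoped Classical
open NumberField IsDedekindDomain Field Matrix

namespace Summit.BirchSwinnertonDyer.BirchSwinnertonDyer.Theorems.SmallImageRttD2Seq

open Literature.NumberTheory.EllipticCurves Literature.NumberTheory.EllipticCurves.GreenbergSelmer Literature.NumberTheory.GaloisRepresentations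

variable {K : Type} [Field K] {p : ℕ} [Fact p.Prime] (S : Set (PadicAlgCl p)) {d : ℕ} (θ : FramedGaloisRep K (padicCoeffIntegers S) d)

/-- **Inertia at an unramified place fixes `Cofree θ F`**: if `θ` is unramified at the finite place `w` (`FramedGaloisRep.IsUnramifiedAt`: `θ = 1` on every `I_𝔓`, `𝔓 ∣ w`), then
every `τ ∈ I_𝔓` acts trivially on `A_θ = Cofree θ F` (`τ • (x mod 𝒪^d) = (θ(τ) x) mod 𝒪^d = x mod 𝒪^d`). [cite: SerreAbelianLadic1968, I §2.1] [cite: EmertonPollackWeston2006, §3.1] -/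
theorem smul_cofree_eq_of_isUnramifiedAt {w : HeightOneSpectrum (𝓞 K)} (hθw : FramedGaloisRep.IsUnramifiedAt w θ)
    {𝔓 : Ideal (absIntegers (𝓞 K) K)} (h𝔓 : 𝔓 ∈ w.primesAbove) {τ : absoluteGaloisGroup K} (hτ : τ ∈ 𝔓.inertia (absoluteGaloisGroup K))
    (a : Cofree θ (padicCoeffField S)) : τ • a = a := by
  have h1 : θ τ = 1 := hθw 𝔓 h𝔓 τ hτ
  obtain ⟨x, rfl⟩ := cofreeMk_surjective _ θ a
  rw [smul_cofreeMk, fracRepresentation_apply_apply, h1, Units.val_one, Matrix.map_one _ (map_zero _) (map_one _), Matrix.one_mulVec]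

/-- **The hypothesis `hMP` of R7 (`RSeq_cofree_lam`, `exists_junction_exact_cofree_lam_of_hsolL`) from unramifiedness of `θ` off `P`**: for every finite place `w ∉ P`, every
prime `𝔓` over `w`, every `τ ∈ I_𝔓` and every `m ∈ Cofree θ F`, `τ • m = m`. [cite: SerreAbelianLadic1968, I §2.1] [cite: GreenbergVatsal2000, §2 pp. 16–17] -/
theorem forall_smul_cofree_eq_of_isUnramifiedOutside {P : Set (HeightOneSpectrum (𝓞 K))} (hθP : ∀ w : HeightOneSpectrum (𝓞 K), w ∉ P → FramedGaloisRep.IsUnramifiedAt w θ) :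
    ∀ w : HeightOneSpectrum (𝓞 K), w ∉ P → ∀ 𝔓 ∈ w.primesAbove, ∀ τ ∈ 𝔓.inertia (absoluteGaloisGroup K), ∀ m : Cofree θ (padicCoeffField S), τ • m = m :=
  fun w hw _ h𝔓 _ hτ m ↦ smul_cofree_eq_of_isUnramifiedAt S θ (hθP w hw) h𝔓 hτ m

end Summit.BirchSwinnertonDyer.BirchSwinnertonDyer.Theorems.SmallImageRttD2Seq

end
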